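import Mathlib
import Literature.Analysis.FluidPDE.VectorCalculus
import Summits.NavierStokesRegularity.NavierStokesRegularity.Theorems.ThreadingFluxHorizonTowerDefs
import HarnessLib

/-!
# Crux `PoloidalLiouville` (stmt-NavierStokesRegularity-1222, W1), crux idea «radial-jerk-tower» (ns-idea-15 g7, lens
# «negation»; critic V21 PASS-WITH-PRICE): DEFINITIONS TWIN of `Cruxes/PoloidalLiouville/ErtelTowerSketch.lean` v1.1

Theorems-side twin (definitions only; experiment cell `ns-wall-extremal`, width hand ns-wall-eng-5 g6, director KEY-NS #186;
0 kit) of the objects and typed statements of the sketch `ErtelTowerSketch.lean` (sha12 0d546a01b9e9), so that the proofs of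
the follow-up files (`ThreadingFluxErtelTowerAlgebra`, `…InviscidStrainRigidity`, `…StrainShadowSurvivor`) can be stated over
importable names and the sketch's Props close BY NAME (`Iff.rfl` guards + `_holds` one-liners, as for `ThreadingFluxCentreJetDefs`).
Bodies are VERBATIM copies of the sketch (its local notation `E` spelled as the abbreviation `E3 = EuclideanSpace ℝ (Fin 3)`),
in the namespace `Summit.NavierStokesRegularity.NavierStokesRegularity.Theorems.PoloidalLiouville.ErtelTower`.

Objects: `polhodeDefect`, `polhodeDefect₁`, `polhodeDefect₂` (the universal polhode-defect profile and its derivatives),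
`dTau₁` (a component of `dτ(x)[w]`), `radialJerk` (the RADIAL-JERK TOWER `θ 0 = ½‖x−x₀‖²`, `θ (k+1) = (∂ₜ + u·∇) θ k`),
`strain` (`x ↦ Sx`, `S = diag(a,b,c)`), `topField` (`τ = Sx × x`), `quadForm` (`xᵀSx`).
Typed statements (Props, none proved here): `ErtelCommutation`, `InviscidRadialJerkTower`, `EulerRadialBernoulli`,
`RadialJerkRankTwo`, `ViscousLevelTwoLaw`, `InviscidKinematicRigidity`, `InviscidStrainRigidity`, `StrainShadowClassification`,
`StrainShadowClassificationLocal`, `StrainShadowLiouville`, `StrainShadowSurvivor`, `PotentialJerkRigidity` — statuses (THEOREM on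
paper / CLASSICAL / CONJECTURE) exactly as labelled in the sketch and the card `Cruxes/PoloidalLiouville/Ideas/radial-jerk-tower.md`.

HONEST FRAME (critic V21-P1/P4 words): everything here lives in the INVISCID (frozen-field) and LINEAR (passive-vector) shadows of
the wall or lists NECESSARY CONDITIONS on unthreaded flows; `StrainShadowSurvivor` is a «false-without-bounded» witness in the
linear STRAIN shadow (prescribed unbounded drift), NOT a `Negative/` entry for ⟨1222⟩; `InviscidStrainRigidity` concerns the
frozen-field equation in the background `Sx`, not ⟨27585⟩.  `PoloidalLiouville` (1222), `stub_scalarLiouville`,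
`UnthreadedRigidity` (27585) and NS regularity are OPEN and untouched.

## References
* H. Ertel, Ein neuer hydrodynamischer Wirbelsatz, Meteorol. Z. 59 (1942) 277–281. [Ertel1942]
* D. J. Acheson, *Elementary Fluid Dynamics* (OUP 1990), Ex. 5.17 p. 125. [Acheson1990]
* A. J. Majda, A. L. Bertozzi, *Vorticity and Incompressible Flow* (CUP 2002), §1.6 Prop. 1.8, Lemma 1.4. [MajdaBertozziCUP2002]
-/

-- the summit and its single problem share the name (D-0017 nested layout)
set_option linter.dupNamespace false

noncomputable section

namespace Summit.NavierStokesRegularity.NavierStokesRegularity.Theorems.PoloidalLiouville.ErtelTower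

open scoped BigOperators Topology InnerProductSpace RealInnerProductSpace
open Filter Set Function
open Summit.NavierStokesRegularity.NavierStokesRegularity.Theorems.PoloidalLiouville.HorizonTower (E3)

/-- The universal polhode-defect profile `F(t) = (b−c)e^{2at} + (c−a)e^{2bt} + (a−b)e^{2ct}`. -/
noncomputable def polhodeDefect (a b c : ℝ) (t : ℝ) : ℝ :=
  (b - c) * Real.exp (2 * a * t) + (c - a) * Real.exp (2 * b * t) + (a - b) * Real.exp (2 * c * t)

/-- Its first derivative. -/
noncomputable def polhodeDefect₁ (a b c : ℝ) (t : ℝ) : ℝ :=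
  (b - c) * (2 * a) * Real.exp (2 * a * t) + (c - a) * (2 * b) * Real.exp (2 * b * t)
    + (a - b) * (2 * c) * Real.exp (2 * c * t)

/-- Its second derivative. -/
noncomputable def polhodeDefect₂ (a b c : ℝ) (t : ℝ) : ℝ :=
  (b - c) * (2 * a) ^ 2 * Real.exp (2 * a * t) + (c - a) * (2 * b) ^ 2 * Real.exp (2 * b * t)
    + (a - b) * (2 * c) ^ 2 * Real.exp (2 * c * t)

/-- First component of `dτ(x)[w]`; the other two are its cyclic images. -/
def dTau₁ (b c x₂ x₃ w₂ w₃ : ℝ) : ℝ := (b - c) * (w₂ * x₃ + x₂ * w₃)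

/-- The RADIAL-JERK TOWER of a drift `u` about `x₀`: `θ 0 = ½‖x − x₀‖²`, `θ (k+1) = (∂ₜ + u·∇)(θ k)`.
`θ 1 t x = ⟪u t x, x − x₀⟫` is the loop momentum of the lineage (g3) (`radialJerk_one`, kernel); on an Euler solution
`θ 2 = ‖u‖² − ⟪x − x₀, ∇p⟫` («radial Bernoulli function»); in a steady linear strain `u = Sx` (x₀ = 0) the tower is
`½‖x‖², xᵀSx, 2xᵀS²x, 4xᵀS³x, …` (`radialJerk_one_strain`, kernel). -/
noncomputable def radialJerk (u : ℝ → E3 → E3) (x₀ : E3) : ℕ → ℝ → E3 → ℝ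
  | 0 => fun _ x => ‖x - x₀‖ ^ 2 / 2
  | k + 1 => fun t x =>
      deriv (fun s => radialJerk u x₀ k s x) t + inner ℝ (u t x) (gradient (radialJerk u x₀ k t) x)

/-- The diagonal strain drift `x ↦ Sx`, `S = diag(a,b,c)` in the standard frame (every symmetric `S` after a rotation;
centre `x₀ = 0` after a translation). -/
noncomputable def strain (a b c : ℝ) (x : E3) : E3 :=
  WithLp.toLp 2 ![a * x 0, b * x 1, c * x 2]

/-- The Euler-top field `τ(x) = Sx × x` (its integral curves on each sphere are the polhodes `sphere ∩ {xᵀSx = const}`). -/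
noncomputable def topField (a b c : ℝ) (x : E3) : E3 :=
  WithLp.toLp 2 ![(b - c) * x 1 * x 2, (c - a) * x 2 * x 0, (a - b) * x 0 * x 1]

/-- The quadratic form `xᵀSx`. -/
noncomputable def quadForm (a b c : ℝ) (x : E3) : ℝ :=
  a * (x 0) ^ 2 + b * (x 1) ^ 2 + c * (x 2) ^ 2

/-- CLASSICAL (Ertel 1942; [corpus:acheson1990 p.125, Ex. 5.17]).  For a smooth incompressible Euler solution on an
open space-time set and ANY smooth scalar `θ`: `D_t ⟪ω, ∇θ⟫ = ⟪ω, ∇(D_t θ)⟫`.  Typed for reference; it is the engine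
of everything below.  (For Navier–Stokes: `(D_t − νΔ)⟪ω,∇θ⟫ = ⟪ω, ∇((D_t − νΔ)θ)⟫ − 2ν Σᵢⱼ ∂ᵢωⱼ ∂ᵢ∂ⱼθ`.) -/
def ErtelCommutation : Prop :=
  ∀ (v : ℝ → E3 → E3) (p θ : ℝ → E3 → ℝ) (I : Set ℝ) (U : Set E3), IsOpen I → IsOpen U →
    ContDiffOn ℝ (⊤ : ℕ∞) (Function.uncurry v) (I ×ˢ U) →
    ContDiffOn ℝ (⊤ : ℕ∞) (Function.uncurry p) (I ×ˢ U) →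
    ContDiffOn ℝ (⊤ : ℕ∞) (Function.uncurry θ) (I ×ˢ U) →
    (∀ t ∈ I, ∀ x ∈ U, deriv (fun s => v s x) t + fderiv ℝ (v t) x (v t x) + gradient (p t) x = 0) →
    (∀ t ∈ I, ∀ x ∈ U, Literature.Analysis.FluidPDE.VectorCalculus.divergence (v t) x = 0) →
    ∀ t ∈ I, ∀ x ∈ U,
      deriv (fun s => inner ℝ (Literature.Analysis.FluidPDE.curl (v s) x) (gradient (θ s) x)) t
        + inner ℝ (v t x)
            (gradient (fun z => inner ℝ (Literature.Analysis.FluidPDE.curl (v t) z) (gradient (θ t) z)) x)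
      = inner ℝ (Literature.Analysis.FluidPDE.curl (v t) x)
          (gradient (fun z => deriv (fun s => θ s z) t + inner ℝ (v t z) (gradient (θ t) z)) x)

/-- THEOREM (Euler, all levels; induction on `k` by `ErtelCommutation`, level 0 = the hypothesis).
INVISCID RADIAL-JERK TOWER: on a smooth incompressible Euler solution whose vortex lines are tangent to the spheres
about `x₀` on `I × U`, EVERY radial jerk `θ_k` is constant along vortex lines:
`⟪ω, ∇θ_k⟫ ≡ 0` for all `k`.  Hence `rank(∇θ₀, ∇θ₁, ∇θ₂, …) ≤ 2` on `{ω ≠ 0}`. -/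
def InviscidRadialJerkTower : Prop :=
  ∀ (v : ℝ → E3 → E3) (p : ℝ → E3 → ℝ) (x₀ : E3) (I : Set ℝ) (U : Set E3), IsOpen I → IsOpen U →
    ContDiffOn ℝ (⊤ : ℕ∞) (Function.uncurry v) (I ×ˢ U) →
    ContDiffOn ℝ (⊤ : ℕ∞) (Function.uncurry p) (I ×ˢ U) →
    (∀ t ∈ I, ∀ x ∈ U, deriv (fun s => v s x) t + fderiv ℝ (v t) x (v t x) + gradient (p t) x = 0) →
    (∀ t ∈ I, ∀ x ∈ U, Literature.Analysis.FluidPDE.VectorCalculus.divergence (v t) x = 0) →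
    (∀ t ∈ I, ∀ x ∈ U, inner ℝ (Literature.Analysis.FluidPDE.curl (v t) x) (x - x₀) = 0) →
    ∀ k : ℕ, ∀ t ∈ I, ∀ x ∈ U,
      inner ℝ (Literature.Analysis.FluidPDE.curl (v t) x) (gradient (radialJerk v x₀ k t) x) = 0

/-- THEOREM (level 2 of the tower in closed form).  RADIAL BERNOULLI LAW: on an unthreaded incompressible Euler flow the
function `‖v‖² − ⟪x − x₀, ∇p⟫ = D_t⟪v, x − x₀⟫` is constant along vortex lines — the inviscid part of the
«order-two threading law» that the lineage found numerically on shells (g3), now for arbitrary smooth unthreaded Euler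
data and with no expansion. -/
def EulerRadialBernoulli : Prop :=
  ∀ (v : ℝ → E3 → E3) (p : ℝ → E3 → ℝ) (x₀ : E3) (I : Set ℝ) (U : Set E3), IsOpen I → IsOpen U →
    ContDiffOn ℝ (⊤ : ℕ∞) (Function.uncurry v) (I ×ˢ U) →
    ContDiffOn ℝ (⊤ : ℕ∞) (Function.uncurry p) (I ×ˢ U) →
    (∀ t ∈ I, ∀ x ∈ U, deriv (fun s => v s x) t + fderiv ℝ (v t) x (v t x) + gradient (p t) x = 0) →
    (∀ t ∈ I, ∀ x ∈ U, Literature.Analysis.FluidPDE.VectorCalculus.divergence (v t) x = 0) →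
    (∀ t ∈ I, ∀ x ∈ U, inner ℝ (Literature.Analysis.FluidPDE.curl (v t) x) (x - x₀) = 0) →
    ∀ t ∈ I, ∀ x ∈ U,
      inner ℝ (Literature.Analysis.FluidPDE.curl (v t) x)
        (gradient (fun z => ‖v t z‖ ^ 2 - inner ℝ (z - x₀) (gradient (p t) z)) x) = 0

/-- THEOREM (pointwise corollary of levels 0–2).  Where `ω ≠ 0`, the first three radial jerk gradients are linearly
dependent: `det(x − x₀, ∇θ₁, ∇θ₂) = 0` — one scalar PDE-free identity every unthreaded Euler flow satisfies on
`{ω ≠ 0}` (and every NS flow satisfies up to the explicit viscous commutator of `ViscousLevelTwoLaw`). -/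
def RadialJerkRankTwo : Prop :=
  ∀ (v : ℝ → E3 → E3) (p : ℝ → E3 → ℝ) (x₀ : E3) (I : Set ℝ) (U : Set E3), IsOpen I → IsOpen U →
    ContDiffOn ℝ (⊤ : ℕ∞) (Function.uncurry v) (I ×ˢ U) →
    ContDiffOn ℝ (⊤ : ℕ∞) (Function.uncurry p) (I ×ˢ U) →
    (∀ t ∈ I, ∀ x ∈ U, deriv (fun s => v s x) t + fderiv ℝ (v t) x (v t x) + gradient (p t) x = 0) →
    (∀ t ∈ I, ∀ x ∈ U, Literature.Analysis.FluidPDE.VectorCalculus.divergence (v t) x = 0) →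
    (∀ t ∈ I, ∀ x ∈ U, inner ℝ (Literature.Analysis.FluidPDE.curl (v t) x) (x - x₀) = 0) →
    ∀ t ∈ I, ∀ x ∈ U, Literature.Analysis.FluidPDE.curl (v t) x ≠ 0 →
      inner ℝ (x - x₀)
        (Literature.Analysis.FluidPDE.cross (gradient (radialJerk v x₀ 1 t) x)
          (gradient (radialJerk v x₀ 2 t) x)) = 0

/-- THEOREM (Navier–Stokes, ν = 1, level 2 with its commutator).  VISCOUS LEVEL-TWO LAW: for a smooth unthreaded NS flow
on `I × U`, with `m = ⟪v, x − x₀⟫`,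
`⟪ω, ∇((∂ₜ + v·∇ − Δ) m)⟫ = 2 Σᵢⱼ ∂ᵢωⱼ ∂ᵢ∂ⱼ m`.
(Level 1 is clean because `∇²(½‖x−x₀‖²) = I` and `div ω = 0`; from level 2 on, viscosity turns the algebraic tower
into differential constraints on `ω` — «viscosity relaxes rigidity into growth», cf. `StrainShadowClassification`.) -/
def ViscousLevelTwoLaw : Prop :=
  ∀ (v : ℝ → E3 → E3) (p : ℝ → E3 → ℝ) (x₀ : E3) (I : Set ℝ) (U : Set E3), IsOpen I → IsOpen U →
    ContDiffOn ℝ (⊤ : ℕ∞) (Function.uncurry v) (I ×ˢ U) →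
    ContDiffOn ℝ (⊤ : ℕ∞) (Function.uncurry p) (I ×ˢ U) →
    (∀ t ∈ I, ∀ x ∈ U, deriv (fun s => v s x) t + fderiv ℝ (v t) x (v t x) + gradient (p t) x
        = Laplacian.laplacian (v t) x) →
    (∀ t ∈ I, ∀ x ∈ U, Literature.Analysis.FluidPDE.VectorCalculus.divergence (v t) x = 0) →
    (∀ t ∈ I, ∀ x ∈ U, inner ℝ (Literature.Analysis.FluidPDE.curl (v t) x) (x - x₀) = 0) →
    ∀ t ∈ I, ∀ x ∈ U,
      let m : ℝ → E3 → ℝ := fun s z => inner ℝ (v s z) (z - x₀)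
      inner ℝ (Literature.Analysis.FluidPDE.curl (v t) x)
          (gradient (fun z => deriv (fun s => m s z) t + inner ℝ (v t z) (gradient (m t) z)
            - Laplacian.laplacian (m t) z) x)
        = 2 * ∑ i : Fin 3, ∑ j : Fin 3,
            (fderiv ℝ (fun z => (Literature.Analysis.FluidPDE.curl (v t) z) j) x (EuclideanSpace.single i 1))
              * (fderiv ℝ (fun z => fderiv ℝ (m t) z (EuclideanSpace.single j 1)) x (EuclideanSpace.single i 1))

/-- THEOREM (inviscid kinematic rigidity, general drift; proof: frozen-field Ertel commutation
`D_t⟪B,∇θ⟫ = ⟪B, ∇D_tθ⟫` [corpus:majda2002 p.26, Lemma 1.4] for levels 0,1,2, then linear algebra where the three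
gradients span, continuity elsewhere).  A field `B` FROZEN into a smooth drift `u` (`∂ₜB + (u·∇)B − (B·∇)u = 0`) and
tangent to the spheres about `x₀` on `I × U` vanishes identically as soon as the drift's radial-jerk tower has full rank
on a dense subset of `U` at each time.  Neither incompressibility of `u` nor `div B = 0` is needed. -/
def InviscidKinematicRigidity : Prop :=
  ∀ (u B : ℝ → E3 → E3) (x₀ : E3) (I : Set ℝ) (U : Set E3), IsOpen I → IsOpen U →
    ContDiffOn ℝ (⊤ : ℕ∞) (Function.uncurry u) (I ×ˢ U) →
    ContDiffOn ℝ (⊤ : ℕ∞) (Function.uncurry B) (I ×ˢ U) →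
    (∀ t ∈ I, ∀ x ∈ U,
      deriv (fun s => B s x) t + fderiv ℝ (B t) x (u t x) - fderiv ℝ (u t) x (B t x) = 0) →
    (∀ t ∈ I, ∀ x ∈ U, inner ℝ (B t x) (x - x₀) = 0) →
    (∀ t ∈ I, U ⊆ closure {x | x ∈ U ∧
        inner ℝ (x - x₀)
          (Literature.Analysis.FluidPDE.cross (gradient (radialJerk u x₀ 1 t) x)
            (gradient (radialJerk u x₀ 2 t) x)) ≠ 0}) →
    ∀ t ∈ I, ∀ x ∈ U, B t x = 0

/-- THEOREM (special case of `InviscidKinematicRigidity` with the kernel lemma `vandermonde_closure`: for `u = Sx` the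
tower is `½‖x‖², xᵀSx, 2xᵀS²x`, whose gradients `x, 2Sx, 4S²x` span off the principal planes).  INVISCID STRAIN
RIGIDITY: no non-zero field frozen into a TRIAXIAL linear strain stays tangent to the spheres about its centre on any
open space-time set — for every triple of pairwise distinct principal strains, incompressible or not. -/
def InviscidStrainRigidity : Prop :=
  ∀ (a b c : ℝ) (B : ℝ → E3 → E3) (I : Set ℝ) (U : Set E3), a ≠ b → b ≠ c → c ≠ a → IsOpen I → IsOpen U →
    ContDiffOn ℝ (⊤ : ℕ∞) (Function.uncurry B) (I ×ˢ U) →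
    (∀ t ∈ I, ∀ x ∈ U,
      deriv (fun s => B s x) t + fderiv ℝ (B t) x (strain a b c x) - strain a b c (B t x) = 0) →
    (∀ t ∈ I, ∀ x ∈ U, inner ℝ (B t x) x = 0) →
    ∀ t ∈ I, ∀ x ∈ U, B t x = 0

/-- THEOREM (paper proof in the card, §P3; kernel skeleton `dTau_strain`, `survivor_balance`, `tau_dot_S2x`).
VISCOUS STRAIN-SHADOW CLASSIFICATION: let `ν > 0` and `S = diag(a,b,c)` be trace-free with pairwise distinct entries.
Every smooth divergence-free solution of the passive viscous vector equation `∂ₜB + (Sx·∇)B − SB = νΔB` on a connected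
open space-time set `I × U` that is tangent to the spheres about the centre is
`B(t,x) = C · exp(xᵀSx / 2ν) · (Sx × x)` for one constant `C`.
In particular the solution space is ONE-dimensional, consists of STEADY fields, none of them axisymmetric, all of them
Gaussian-growing along every extensional principal axis.  Proof chain: `f = ⟪B,x⟫ ≡ 0 ⇒ g = ⟪B,Sx⟫ ≡ 0 ⇒
⟪B,S²x⟫ = ν div(SB)` (the transport equations of `f` and `g`), then `B = σ·(Sx × x)` with `∇σ ⊥ τ`, the last identity
forces `σ = exp(xᵀSx/2ν)·h(‖x‖², t)`, and the `τ`-component of the equation reads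
`hₜ − (xᵀSx) h₁ − 7ν h₁ − ν‖x‖² h₁₁ = 0`, whence `h₁ = 0 = hₜ`; globalisation by continuity across the principal
planes (V21-P2, see `StrainShadowClassificationLocal`; v1.0 said «analyticity in x» — not needed). -/
def StrainShadowClassification : Prop :=
  ∀ (ν a b c : ℝ) (B : ℝ → E3 → E3) (I : Set ℝ) (U : Set E3), 0 < ν → a ≠ b → b ≠ c → c ≠ a → a + b + c = 0 →
    IsOpen I → IsPreconnected I → IsOpen U → IsPreconnected U →
    ContDiffOn ℝ (⊤ : ℕ∞) (Function.uncurry B) (I ×ˢ U) →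
    (∀ t ∈ I, ∀ x ∈ U, Literature.Analysis.FluidPDE.VectorCalculus.divergence (B t) x = 0) →
    (∀ t ∈ I, ∀ x ∈ U,
      deriv (fun s => B s x) t + fderiv ℝ (B t) x (strain a b c x) - strain a b c (B t x)
        = ν • Laplacian.laplacian (B t) x) →
    (∀ t ∈ I, ∀ x ∈ U, inner ℝ (B t x) x = 0) →
    ∃ C : ℝ, ∀ t ∈ I, ∀ x ∈ U, B t x = (C * Real.exp (quadForm a b c x / (2 * ν))) • topField a b c x

/-- THEOREM (M rung, V21-P2; the global statement above is its corollary).  LOCAL STRAIN-SHADOW CLASSIFICATION OFF THE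
PRINCIPAL PLANES: the same conclusion on an open preconnected `U` avoiding the three principal planes `{xᵢ = 0}` — there
`(★) ⟪Sx, S²x × x⟫ = V·x₁x₂x₃ ≠ 0` and `τ = Sx × x ≠ 0` everywhere, so `σ = B/τ` is a globally defined smooth scalar on
`U`, the two transport identities give `σ = exp(xᵀSx/2ν)·k` with `∇k ∥ x`, and the `τ`-component ODE forces `k`
constant; NO analyticity and no gluing are needed.  (Globalisation to a general connected `U`, V21-P2: `k` is locally
constant on `U ∖ ⋃{xᵢ = 0}`, `τ ≠ 0` on the planes off the axes, continuity of `B` across the planes and connectedness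
of `U` glue the octant constants — replaces the «analytic in x» sentence of v1.0.) -/
def StrainShadowClassificationLocal : Prop :=
  ∀ (ν a b c : ℝ) (B : ℝ → E3 → E3) (I : Set ℝ) (U : Set E3), 0 < ν → a ≠ b → b ≠ c → c ≠ a → a + b + c = 0 →
    IsOpen I → IsPreconnected I → IsOpen U → IsPreconnected U →
    U ⊆ {x | x 0 ≠ 0 ∧ x 1 ≠ 0 ∧ x 2 ≠ 0} →
    ContDiffOn ℝ (⊤ : ℕ∞) (Function.uncurry B) (I ×ˢ U) →
    (∀ t ∈ I, ∀ x ∈ U, Literature.Analysis.FluidPDE.VectorCalculus.divergence (B t) x = 0) →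
    (∀ t ∈ I, ∀ x ∈ U,
      deriv (fun s => B s x) t + fderiv ℝ (B t) x (strain a b c x) - strain a b c (B t x)
        = ν • Laplacian.laplacian (B t) x) →
    (∀ t ∈ I, ∀ x ∈ U, inner ℝ (B t x) x = 0) →
    ∃ C : ℝ, ∀ t ∈ I, ∀ x ∈ U, B t x = (C * Real.exp (quadForm a b c x / (2 * ν))) • topField a b c x

/-- THEOREM (corollary).  STRAIN-SHADOW LIOUVILLE: in the bounded class the viscous strain shadow is empty — a bounded
smooth divergence-free sphere-tangent solution of the passive viscous equation in a trace-free triaxial strain on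
`I × ℝ³` (`I` any open interval, e.g. `(−∞,0)`) vanishes identically.  This is the linear shadow of the wall at a
triaxial stagnation centre, DECIDED; boundedness is load-bearing (next item). -/
def StrainShadowLiouville : Prop :=
  ∀ (ν a b c : ℝ) (B : ℝ → E3 → E3) (I : Set ℝ), 0 < ν → a ≠ b → b ≠ c → c ≠ a → a + b + c = 0 →
    IsOpen I → IsPreconnected I →
    ContDiffOn ℝ (⊤ : ℕ∞) (Function.uncurry B) (I ×ˢ Set.univ) →
    (∀ t ∈ I, ∀ x, Literature.Analysis.FluidPDE.VectorCalculus.divergence (B t) x = 0) →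
    (∀ t ∈ I, ∀ x,
      deriv (fun s => B s x) t + fderiv ℝ (B t) x (strain a b c x) - strain a b c (B t x)
        = ν • Laplacian.laplacian (B t) x) →
    (∀ t ∈ I, ∀ x, inner ℝ (B t x) x = 0) →
    (∃ C : ℝ, ∀ t ∈ I, ∀ x, ‖B t x‖ ≤ C) →
    ∀ t ∈ I, ∀ x, B t x = 0

/-- THEOREM (direct calculus; algebraic skeleton kernel-checked in Part A).  THE SURVIVOR — `false-without-bounded` for the
strain shadow: `B⋆(x) = exp(xᵀSx/2ν)·(Sx × x)` is a smooth, steady, divergence-free, sphere-tangent, NON-ZERO solution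
of the passive viscous equation in the strain `Sx` on all of `ℝ³` (unbounded: `‖B⋆(0,s,s)‖ = |b−c| s² e^{−a s²/2ν}` with
`a < 0` the compressive rate).  So already in the linear shadow nothing short of the boundedness hypothesis of
`PoloidalLiouville` excludes unthreaded configurations. -/
def StrainShadowSurvivor : Prop :=
  ∀ (ν a b c : ℝ), 0 < ν → a + b + c = 0 →
    let Bs : E3 → E3 := fun x => Real.exp (quadForm a b c x / (2 * ν)) • topField a b c x
    (∀ x, fderiv ℝ Bs x (strain a b c x) - strain a b c (Bs x) = ν • Laplacian.laplacian Bs x) ∧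
    (∀ x, Literature.Analysis.FluidPDE.VectorCalculus.divergence Bs x = 0) ∧
    (∀ x, inner ℝ (Bs x) x = 0) ∧
    (a ≠ b ∨ b ≠ c ∨ c ≠ a → ∃ x, Bs x ≠ 0)

/-- CONJECTURE (typed target; quadratic level = `vandermonde_closure`, cubic test case `h = x₁x₂x₃` has full rank).
POTENTIAL JERK RIGIDITY: a harmonic function near `x₀` whose radial-jerk tower (drift `u = ∇h`, steady) has rank ≤ 2
everywhere is axisymmetric about a line through `x₀`.  Together with `InviscidKinematicRigidity` it DECIDES the
inviscid linearised local wall (W2) about every potential background: either the background is axisymmetric about an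
axis through the centre, or no frozen sphere-tangent field exists near the centre. -/
def PotentialJerkRigidity : Prop :=
  ∀ (h : E3 → ℝ) (x₀ : E3) (R : ℝ), 0 < R → ContDiffOn ℝ (⊤ : ℕ∞) h (Metric.ball x₀ R) →
    (∀ x ∈ Metric.ball x₀ R, Laplacian.laplacian h x = 0) →
    (let θ : ℕ → E3 → ℝ := fun k => radialJerk (fun _ z => gradient h z) x₀ k 0
     ∀ j k l : ℕ, ∀ x ∈ Metric.ball x₀ R,
      inner ℝ (gradient (θ j) x) (Literature.Analysis.FluidPDE.cross (gradient (θ k) x) (gradient (θ l) x)) = 0) →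
    ∃ e : E3, e ≠ 0 ∧ ∀ x ∈ Metric.ball x₀ R, fderiv ℝ h x (Literature.Analysis.FluidPDE.cross e (x - x₀)) = 0

end Summit.NavierStokesRegularity.NavierStokesRegularity.Theorems.PoloidalLiouville.ErtelTower
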